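import Mathlib
import Summits.NavierStokesRegularity.NavierStokesRegularity.Theorems.SubOnsagerCeilingKPDarkShellBarrier
import Summits.NavierStokesRegularity.NavierStokesRegularity.Theorems.SubcriticalEnvelopeForwardSourceTailEnvelopeKPPerm
import HarnessLib

/-!
# MIXED KP permutation networks — every `σ`-orbit either UNIFORM (a Katz–Pavlović cycle) or BROKEN (a dead feed) —
# satisfy the primary graded barrier: the recurrent core by the strand transfer, the rest by the dark-shell corner
# (helper file for crux stmt-NavierStokesRegularity-27057 `SubOnsagerCeiling.ForwardTailCeilingKP`, `--supports`;
# sequel of `SubOnsagerCeilingKPDarkShellBarrier` and of LEAD SE's `SubcriticalEnvelopeForwardSourceTailEnvelopeKPPerm`)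

The worked TEMPLATE for combining a RECURRENT core with the non-recurrent corner inside one grading of the LEAD
skeleton's `PrimaryGradedAt` (Cruxes/ForwardTailCeilingKP/Lines/kp_shell_barrier.lean; registered stubs
`stub_primaryGradedLargeRatio` / `stub_primaryGradedSmallRatio`).  For LEAD SE's permutation networks
`kpPermTable σ c` (feed `a → σ a` with weight `c a`), RUNG 6 (`rung_kpPerm`) needs `c` constant on EVERY orbit.
Here each mode `i` is either on a UNIFORM orbit (`c` constant on the cycle of `i`, `c i ≠ 0`: its strand is an
honest `(c i)`-chain — §1, the orbit-local form of LEAD SE's honesty transfer) or has a DEAD PREDECESSOR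
(`c (σ^{-(j+1)} i) = 0` for some `j < 4`: it is dark from shell `4` on along the certificate
`A n = {i : the n predecessors of i have live feeds}` — §2, `kpProper_eventuallyDark_barrier`):

* §1 `quadTerm_permStrand_local`, `permStrand_honest_local` — strands on one uniform orbit are honest chains;
* §2 `kpPerm_litCert_feed`, `kpPerm_litCert_dark` — the predecessor certificate and its darkness;
* §3 `kpPerm_mixed_primaryGraded_of_chain` — CONDITIONAL TRANSFER: any ν-uniform chain bound with constants
  `(θ, D)`, `1/2 < θ ≤ 1`, `D ≥ 1`, at ratio `1+ε₀` for the live weights gives the conclusion of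
  `PrimaryGradedAt R ε₀ (kpPermTable σ c)` for every mixed network (grading `lev ≡ 0`, the same `θ`,
  `D' = D + ((1+ε₀)²)^4`);
* §4 `kpPerm_mixed_primaryGraded_range` — DISCHARGED on `ε₀ ∈ [7/10, 1]` by ns-soc-p2's chain rung
  `dyadicRange_shellBarrier` (`θ = 101/200`, `D = 100`) BY NAME; every other chain rung transfers the same way.
  Example: `σ = (0 1)(2 3)`, `c = (1, 1, 1, 0)` — a uniform 2-cycle on `{0,1}` next to the broken path `2 → 3`.

HONEST FRAMING: statements about Tao-type MODEL lattice ODEs (route SubOnsagerCeiling, rung TL-M2Break); the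
recurrent content is LEAD SE's / ns-soc-p2's (cited by name), the new part is bookkeeping; nothing here bears on
Navier–Stokes regularity and no stub, crux or summit is proved. [cite: Tao2016AveragedNS, §4 (4.2)–(4.3), (4.13)]
[cite: BarbatoMorandinRomito2011, §2 Lemma 2.1, §3.2]
-/

noncomputable section

-- the sub-problem namespace `NavierStokesRegularity.NavierStokesRegularity` is the tree's layout (D-0017)
set_option linter.dupNamespace false

namespace Summit.NavierStokesRegularity.NavierStokesRegularity.Theorems

open Set Finset
open Literature.Analysis.FluidPDE.TaoCascade

/-! ## §1 Strands on one uniform orbit are honest chains (orbit-local honesty transfer) -/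

/-- **Intertwining on ONE uniform orbit.**  If `c` is constant along the orbit of `a₀`
(`c (permPhase σ a₀ k) = c a₀` for all `k`), then along ANY family `X` the `(c a₀)·dyadicTable` nonlinearity of
the strand of `a₀` equals the network nonlinearity of the mode it occupies (LEAD SE's `quadTerm_permStrand`
with the orbit-constancy hypothesis localised to the orbit of `a₀`). Pure algebra. [this file] -/
theorem quadTerm_permStrand_local (ε₀ : ℝ) {σ : Equiv.Perm (Fin 4)} {c : Fin 4 → ℝ} (a₀ : Fin 4)
    (hloc : ∀ k : ℤ, c (permPhase σ a₀ k) = c a₀) (X : Fin 4 → ℤ → ℝ → ℝ) (n : ℤ) (t : ℝ) :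
    quadTerm ε₀ (fun i₁ i₂ i₃ μ => c a₀ * dyadicTable i₁ i₂ i₃ μ) (permStrand σ a₀ X) 0 n t =
      quadTerm ε₀ (kpPermTable σ c) X (permPhase σ a₀ n) n t := by
  rw [dyadicRatioTwo_quadTerm_const_mul (β := dyadicTable) (c := c a₀) (fun _ _ _ _ => rfl),
    quadTerm_dyadicTable_zero, quadTerm_kpPerm_phase, hloc, hloc]
  ring

/-- **Honesty transfer to a strand on ONE uniform orbit** (LEAD SE's `permStrand_honest`, orbit-local form): if
`X` satisfies the solution clauses for `kpPermTable σ c` on `[0,s]` from the one-shell datum `X₀` and is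
non-negative on shells `≥ 1`, and `c` is constant along the orbit of `a₀`, then `permStrand σ a₀ X` satisfies them
for `(c a₀)·dyadicTable` from the datum `X₀(a₀)·e₀`. MODEL lattice bookkeeping. [this file] -/
theorem permStrand_honest_local {ε₀ ν s : ℝ} {σ : Equiv.Perm (Fin 4)} {c : Fin 4 → ℝ} (a₀ : Fin 4)
    (hloc : ∀ k : ℤ, c (permPhase σ a₀ k) = c a₀) {X₀ : Fin 4 → ℝ} {X : Fin 4 → ℤ → ℝ → ℝ}
    (hinit : ∀ (i : Fin 4) (k : ℤ), X i k 0 = if k = 0 then X₀ i else 0)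
    (hlow : ∀ (i : Fin 4) (k : ℤ), k < 0 → ∀ t : ℝ, X i k t = 0)
    (hbd : ∃ M : ℝ, ∀ (t : ℝ) (i : Fin 4) (k : ℤ), (1 + (1 + ε₀) ^ ((10 : ℝ) * k)) * |X i k t| ≤ M)
    (hcont : ∀ (i : Fin 4) (k : ℤ), Continuous (X i k))
    (hder : ∀ (i : Fin 4) (k : ℤ), ∀ t ∈ Icc (0 : ℝ) s, HasDerivWithinAt (X i k)
      (quadTerm ε₀ (kpPermTable σ c) X i k t - ν * (1 + ε₀) ^ ((2 : ℝ) * k) * X i k t)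
      (Icc (0 : ℝ) s) t)
    (hnn : ∀ t ∈ Icc (0 : ℝ) s, ∀ (i : Fin 4) (k : ℤ), 1 ≤ k → 0 ≤ X i k t) :
    (∀ (i : Fin 4) (k : ℤ), permStrand σ a₀ X i k 0 =
        if k = 0 then (fun i : Fin 4 => if i = 0 then X₀ a₀ else 0) i else 0) ∧
    (∀ (i : Fin 4) (k : ℤ), k < 0 → ∀ t : ℝ, permStrand σ a₀ X i k t = 0) ∧
    (∃ M : ℝ, ∀ (t : ℝ) (i : Fin 4) (k : ℤ),
      (1 + (1 + ε₀) ^ ((10 : ℝ) * k)) * |permStrand σ a₀ X i k t| ≤ M) ∧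
    (∀ (i : Fin 4) (k : ℤ), Continuous (permStrand σ a₀ X i k)) ∧
    (∀ (i : Fin 4) (k : ℤ), ∀ t ∈ Icc (0 : ℝ) s, HasDerivWithinAt (permStrand σ a₀ X i k)
      (quadTerm ε₀ (fun i₁ i₂ i₃ μ => c a₀ * dyadicTable i₁ i₂ i₃ μ) (permStrand σ a₀ X) i k t -
        ν * (1 + ε₀) ^ ((2 : ℝ) * k) * permStrand σ a₀ X i k t) (Icc (0 : ℝ) s) t) ∧
    (∀ t ∈ Icc (0 : ℝ) s, ∀ (i : Fin 4) (k : ℤ), 1 ≤ k → 0 ≤ permStrand σ a₀ X i k t) := by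
  obtain ⟨M, hM⟩ := hbd
  have hM0 : 0 ≤ M := by
    have h := hM 0 0 0
    have h1 : (0 : ℝ) ≤ (1 + (1 + ε₀) ^ ((10 : ℝ) * ((0 : ℤ) : ℝ))) * |X 0 0 0| := by
      have : (1 + ε₀) ^ ((10 : ℝ) * ((0 : ℤ) : ℝ)) = 1 := by simp
      rw [this]; positivity
    exact h1.trans h
  refine ⟨fun i k => ?_, fun i k hk t => ?_, ⟨M, fun t i k => ?_⟩, fun i k => ?_, fun i k t ht => ?_,
    fun t ht i k hk => ?_⟩
  · by_cases hi : i = 0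
    · subst hi
      rw [permStrand_zero, hinit]
      by_cases hk : k = 0
      · subst hk; simp [permPhase_zero]
      · simp [hk]
    · rw [permStrand_of_ne σ a₀ X hi]
      by_cases hk : k = 0 <;> simp [hk, hi]
  · by_cases hi : i = 0
    · subst hi; rw [permStrand_zero]; exact hlow _ k hk t
    · exact permStrand_of_ne σ a₀ X hi k t
  · by_cases hi : i = 0
    · subst hi; rw [permStrand_zero]; exact hM t _ k
    · rw [permStrand_of_ne σ a₀ X hi, abs_zero, mul_zero]; exact hM0
  · by_cases hi : i = 0
    · subst hi
      have : permStrand σ a₀ X 0 k = X (permPhase σ a₀ k) k :=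
        funext fun t => permStrand_zero σ a₀ X k t
      rw [this]; exact hcont _ k
    · have : permStrand σ a₀ X i k = fun _ => 0 := funext fun t => permStrand_of_ne σ a₀ X hi k t
      rw [this]; exact continuous_const
  · by_cases hi : i = 0
    · subst hi
      have hfun : permStrand σ a₀ X 0 k = X (permPhase σ a₀ k) k :=
        funext fun t => permStrand_zero σ a₀ X k t
      rw [hfun, quadTerm_permStrand_local ε₀ a₀ hloc]
      exact hder _ k t ht
    · have hfun : permStrand σ a₀ X i k = fun _ => 0 :=
        funext fun t => permStrand_of_ne σ a₀ X hi k t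
      have hq : quadTerm ε₀ (fun i₁ i₂ i₃ μ => c a₀ * dyadicTable i₁ i₂ i₃ μ) (permStrand σ a₀ X) i k t
          = 0 := dyadicRatioTwo_quadTerm_of_ne (fun _ _ _ _ => rfl) _ hi k t
      rw [hfun, hq]
      simpa using hasDerivWithinAt_const t (Icc (0 : ℝ) s) (0 : ℝ)
  · by_cases hi : i = 0
    · subst hi; rw [permStrand_zero]; exact hnn t ht _ k hk
    · rw [permStrand_of_ne σ a₀ X hi]

/-- On the orbit of a mode `i` with `c` constant on its cycle, every strand start `a₀ = σ^{-k} i` sees the same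
constant: `c (permPhase σ (permPhase σ i (-k)) k') = c (permPhase σ i (-k))`. [this file] -/
theorem kpPerm_orbitConst_start {σ : Equiv.Perm (Fin 4)} {c : Fin 4 → ℝ} {i : Fin 4}
    (hunif : ∀ b, σ.SameCycle i b → c b = c i) (k k' : ℤ) :
    c (permPhase σ (permPhase σ i (-k)) k') = c (permPhase σ i (-k)) := by
  have h1 : σ.SameCycle i (permPhase σ (permPhase σ i (-k)) k') := by
    refine ⟨k' + -k, ?_⟩
    simp only [permPhase]
    rw [zpow_add, Equiv.Perm.mul_apply]
  have h2 : σ.SameCycle i (permPhase σ i (-k)) := ⟨-k, rfl⟩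
  rw [hunif _ h1, hunif _ h2]

/-! ## §2 The predecessor certificate of a permutation network -/

/-- One step back along `σ` inside an iterate: `(σ.symm ^ (j+1)) (σ a) = (σ.symm ^ j) a`. [folklore] -/
theorem kpPerm_symm_pow_succ_apply (σ : Equiv.Perm (Fin 4)) (a : Fin 4) (j : ℕ) :
    (σ.symm ^ (j + 1)) (σ a) = (σ.symm ^ j) a := by
  rw [pow_succ, Equiv.Perm.mul_apply, Equiv.symm_apply_apply]

/-- **The predecessor certificate is a lit-set certificate**: with
`A n = {i : c ((σ.symm)^(j+1) i) ≠ 0 for all j < n}` (the `n` predecessors of `i` along `σ` have live feeds), no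
mode of `A n` feeds a mode outside `A (n+1)`. [this file] -/
theorem kpPerm_litCert_feed (σ : Equiv.Perm (Fin 4)) (c : Fin 4 → ℝ) (n : ℕ) (i : Fin 4)
    (hi : i ∉ Finset.univ.filter (fun i : Fin 4 => ∀ j < n + 1, c ((σ.symm ^ (j + 1)) i) ≠ 0))
    (a : Fin 4) (ha : a ∈ Finset.univ.filter (fun i : Fin 4 => ∀ j < n, c ((σ.symm ^ (j + 1)) i) ≠ 0)) :
    kpPermTable σ c a a i (0, 0, 1) = 0 := by
  simp only [Finset.mem_filter, Finset.mem_univ, true_and] at hi ha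
  rw [kpPermTable_feed]
  by_cases h : a = a ∧ i = σ a
  · rw [if_pos h]
    by_contra hca
    apply hi
    intro j hj
    rw [h.2]
    cases j with
    | zero => simpa using hca
    | succ j =>
      rw [kpPerm_symm_pow_succ_apply]
      exact ha j (by omega)
  · rw [if_neg h]

/-- A mode with a dead predecessor within `j+1 ≤ 4` steps is outside the predecessor certificate from shell `4` on.
[this file] -/
theorem kpPerm_litCert_dark (σ : Equiv.Perm (Fin 4)) (c : Fin 4 → ℝ) {i : Fin 4} {j : ℕ} (hj : j < 4)
    (hdead : c ((σ.symm ^ (j + 1)) i) = 0) (n : ℕ) (hn : 4 ≤ n) :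
    i ∉ Finset.univ.filter (fun i : Fin 4 => ∀ j < n, c ((σ.symm ^ (j + 1)) i) ≠ 0) := by
  simp only [Finset.mem_filter, Finset.mem_univ, true_and, not_forall, not_not]
  exact ⟨j, by omega, hdead⟩

/-! ## §3 The conditional transfer for mixed permutation networks -/

/-- **MIXED PERMUTATION NETWORKS: chain bound ⇒ primary graded barrier (conditional transfer).**  Let every
mode `i` of `kpPermTable σ c` be either on a UNIFORM LIVE orbit (`c` constant on the cycle of `i`, `c i ≠ 0`) or
have a DEAD PREDECESSOR (`c (σ.symm^(j+1) i) = 0` for some `j < 4`).  If at ratio `1+ε₀` every honest viscous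
solution of the `(c a)·dyadicTable` chain (`c a > 0`) obeys the weighted bound with constants `(θ₀, D₀)`,
`1/2 < θ₀ ≤ 1`, `D₀ ≥ 1`, then the conclusion of the LEAD skeleton's `PrimaryGradedAt R ε₀ (kpPermTable σ c)`
holds with the grading `lev ≡ 0`, the same `θ₀` and `D = D₀ + ((1+ε₀)²)^4`: uniform-orbit modes by the
orbit-local strand transfer (§1), dead-predecessor modes by `kpProper_eventuallyDark_barrier` along the
predecessor certificate (§2; `θ₀ ≤ 1` lets the `θ = 1` bound serve).  The chain hypothesis is discharged by ANY
chain rung of ns-soc-p2 (§4 does it on `[7/10, 1]`). MODEL lattice statement; no stub, crux or summit is proved.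
[cite: BarbatoMorandinRomito2011, §3.2] [cite: Tao2016AveragedNS, §4 (4.13)] -/
theorem kpPerm_mixed_primaryGraded_of_chain (σ : Equiv.Perm (Fin 4)) (c : Fin 4 → ℝ) {ε₀ θ₀ D₀ : ℝ}
    (hε : 0 < ε₀) (hθ₀ : 1 / 2 < θ₀) (hθ₁ : θ₀ ≤ 1) (hD₀ : 1 ≤ D₀)
    (hmix : ∀ i : Fin 4, ((∀ b, σ.SameCycle i b → c b = c i) ∧ c i ≠ 0) ∨
      ∃ j : ℕ, j < 4 ∧ c ((σ.symm ^ (j + 1)) i) = 0)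
    (hchain : ∀ a : Fin 4, 0 < c a → ∀ ν : ℝ, 0 < ν → ∀ (Y₀ : Fin 4 → ℝ) (s : ℝ), 0 < s →
      ∀ Y : Fin 4 → ℤ → ℝ → ℝ,
      (∀ (i : Fin 4) (k : ℤ), Y i k 0 = if k = 0 then Y₀ i else 0) →
      (∀ (i : Fin 4) (k : ℤ), k < 0 → ∀ t : ℝ, Y i k t = 0) →
      (∃ M : ℝ, ∀ (t : ℝ) (i : Fin 4) (k : ℤ), (1 + (1 + ε₀) ^ ((10 : ℝ) * k)) * |Y i k t| ≤ M) →
      (∀ (i : Fin 4) (k : ℤ), Continuous (Y i k)) →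
      (∀ (i : Fin 4) (k : ℤ), ∀ t ∈ Set.Icc (0 : ℝ) s, HasDerivWithinAt (Y i k)
        (quadTerm ε₀ (fun i₁ i₂ i₃ μ => c a * dyadicTable i₁ i₂ i₃ μ) Y i k t -
          ν * (1 + ε₀) ^ ((2 : ℝ) * k) * Y i k t) (Set.Icc (0 : ℝ) s) t) →
      (∀ t ∈ Set.Icc (0 : ℝ) s, ∀ (i : Fin 4) (k : ℤ), 1 ≤ k → 0 ≤ Y i k t) →
      ∀ t ∈ Set.Icc (0 : ℝ) s, ∀ (i : Fin 4) (k : ℕ),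
        (1 + ε₀) ^ (2 * θ₀ * (k : ℝ)) * ((1 / 2 : ℝ) * Y i (k : ℤ) t ^ 2) ≤
          D₀ * (∑ j : Fin 4, (1 / 2 : ℝ) * Y₀ j ^ 2))
    (R : ℝ) :
    Literature.Analysis.FluidPDE.TaoCascade.InTableClass R (kpPermTable σ c) →
    (∀ (Y : Fin 4 → ℤ → ℝ → ℝ) (τ : ℝ), (∀ (j : Fin 4) (k : ℤ), 1 ≤ k → 0 ≤ Y j k τ) → ∀ δ : ℝ, 0 < δ →
      ∀ (i : Fin 4) (n : ℤ), 1 ≤ n → Y i n τ = 0 →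
        0 ≤ Literature.Analysis.FluidPDE.TaoCascade.quadTerm δ (kpPermTable σ c) Y i n τ) →
    (∀ a b i : Fin 4, a ≠ b → kpPermTable σ c a b i (0, 0, 1) = 0) →
    ∃ (lev : Fin 4 → ℕ) (L : ℕ), (∀ a, lev a ≤ L) ∧
      (∀ a, lev a ≠ 0 → (∃ e, kpPermTable σ c a a e (0, 0, 1) ≠ 0) →
        (∀ j, kpPermTable σ c j j a (0, 0, 1) ≠ 0 →
          lev j < lev a ∧ (lev j = 0 ∨ ∃ e', kpPermTable σ c j j e' (0, 0, 1) ≠ 0)) ∧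
        (∀ i₁ i₂, i₁ ≠ a → i₂ ≠ a → kpPermTable σ c i₁ i₂ a (0, 0, 0) ≠ 0 →
          (lev i₁ < lev a ∧ (lev i₁ = 0 ∨ ∃ e', kpPermTable σ c i₁ i₁ e' (0, 0, 1) ≠ 0)) ∧
          (lev i₂ < lev a ∧ (lev i₂ = 0 ∨ ∃ e', kpPermTable σ c i₂ i₂ e' (0, 0, 1) ≠ 0))) ∧
        (∃ e, kpPermTable σ c a a e (0, 0, 1) ≠ 0 ∧
          (∀ j, kpPermTable σ c e e j (0, 0, 1) ≠ 0 →
            lev j < lev a ∧ (lev j = 0 ∨ ∃ e', kpPermTable σ c j j e' (0, 0, 1) ≠ 0)) ∧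
          (∀ j, j ≠ e → kpPermTable σ c e e j (0, 0, 0) ≠ 0 →
            lev j < lev a ∧ (lev j = 0 ∨ ∃ e', kpPermTable σ c j j e' (0, 0, 1) ≠ 0)))) ∧
      ∃ θ : ℝ, 1 / 2 < θ ∧ θ ≤ 1 ∧ ∃ D : ℝ, 0 ≤ D ∧
        ∀ ν : ℝ, 0 < ν → ∀ (X₀ : Fin 4 → ℝ) (s : ℝ), 0 < s → ∀ X : Fin 4 → ℤ → ℝ → ℝ,
        (∀ (i : Fin 4) (k : ℤ), X i k 0 = if k = 0 then X₀ i else 0) →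
        (∀ (i : Fin 4) (k : ℤ), k < 0 → ∀ t : ℝ, X i k t = 0) →
        (∃ M : ℝ, ∀ (t : ℝ) (i : Fin 4) (k : ℤ), (1 + (1 + ε₀) ^ ((10 : ℝ) * k)) * |X i k t| ≤ M) →
        (∀ (i : Fin 4) (k : ℤ), Continuous (X i k)) →
        (∀ (i : Fin 4) (k : ℤ), ∀ t ∈ Set.Icc (0 : ℝ) s, HasDerivWithinAt (X i k)
          (Literature.Analysis.FluidPDE.TaoCascade.quadTerm ε₀ (kpPermTable σ c) X i k t -
            ν * (1 + ε₀) ^ ((2 : ℝ) * k) * X i k t) (Set.Icc (0 : ℝ) s) t) →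
        (∀ t ∈ Set.Icc (0 : ℝ) s, ∀ (i : Fin 4) (k : ℤ), 1 ≤ k → 0 ≤ X i k t) →
        ∀ t ∈ Set.Icc (0 : ℝ) s, ∀ i, lev i = 0 → ∀ k : ℕ,
          (1 + ε₀) ^ (2 * θ * (k : ℝ)) * ((1 / 2 : ℝ) * X i (k : ℤ) t ^ 2) ≤
            D * (∑ j : Fin 4, (1 / 2 : ℝ) * X₀ j ^ 2) := by
  intro hT hO hDg
  obtain ⟨hsy, hca, hcomp⟩ := hT
  have hα1 : ∀ (a b i : Fin 4) (μ : ℤ × ℤ × ℤ), μ ∈ shiftSet → |kpPermTable σ c a b i μ| ≤ 1 :=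
    fun a b i μ hμ => (hcomp a b i μ hμ).1
  have hc0 : ∀ a, 0 ≤ c a := kpPerm_coeff_nonneg_of_orthant hO
  have hb1 : (1 : ℝ) ≤ 1 + ε₀ := by linarith
  refine ⟨fun _ => 0, 0, fun _ => le_rfl, fun a ha => absurd rfl ha, θ₀, hθ₀, hθ₁,
    D₀ + ((1 + ε₀) ^ 2) ^ 4, by positivity, ?_⟩
  intro ν hν X₀ s hs X hdat hvan hbdd hXc hode hnn t ht i _ k
  set E₀ : ℝ := ∑ j : Fin 4, (1 / 2 : ℝ) * X₀ j ^ 2 with hE₀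
  have hE₀0 : 0 ≤ E₀ := Finset.sum_nonneg fun j _ => by positivity
  have hE₀i : ∀ j : Fin 4, (1 / 2 : ℝ) * X₀ j ^ 2 ≤ E₀ := fun j =>
    Finset.single_le_sum (f := fun j => (1 / 2 : ℝ) * X₀ j ^ 2) (fun j _ => by positivity) (Finset.mem_univ j)
  have hpow4 : 0 ≤ ((1 + ε₀) ^ 2) ^ 4 := by positivity
  rcases hmix i with ⟨hunif, hci⟩ | ⟨j, hj, hdead⟩
  · -- a mode on a uniform live orbit: the strand through `(i, k)` is an honest `(c a₀)`-chain
    set a₀ : Fin 4 := permPhase σ i (-(k : ℤ)) with ha₀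
    have hloc : ∀ k' : ℤ, c (permPhase σ a₀ k') = c a₀ := fun k' => kpPerm_orbitConst_start hunif (k : ℤ) k'
    have hcai : c a₀ = c i := hunif _ ⟨-(k : ℤ), rfl⟩
    have hca0 : 0 < c a₀ := lt_of_le_of_ne (hc0 a₀) (by rw [hcai]; exact Ne.symm hci)
    obtain ⟨h1, h2, h3, h4, h5, h6⟩ := permStrand_honest_local (ν := ν) a₀ hloc hdat hvan hbdd hXc hode hnn
    have hB := hchain a₀ hca0 ν hν _ s hs (permStrand σ a₀ X) h1 h2 h3 h4 h5 h6 t ht 0 k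
    rw [permStrand_zero, ha₀, permPhase_start] at hB
    have hdat₀ : (∑ j : Fin 4, (1 / 2 : ℝ) * (if j = 0 then X₀ a₀ else 0) ^ 2) = (1 / 2 : ℝ) * X₀ a₀ ^ 2 := by
      simp
    rw [hdat₀] at hB
    have hD₀0 : 0 ≤ D₀ := le_trans zero_le_one hD₀
    calc (1 + ε₀) ^ (2 * θ₀ * (k : ℝ)) * ((1 / 2 : ℝ) * X i (k : ℤ) t ^ 2)
        ≤ D₀ * ((1 / 2 : ℝ) * X₀ a₀ ^ 2) := hB
      _ ≤ D₀ * E₀ := mul_le_mul_of_nonneg_left (hE₀i a₀) hD₀0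
      _ ≤ (D₀ + ((1 + ε₀) ^ 2) ^ 4) * E₀ := by nlinarith
  · -- a mode with a dead predecessor: dark from shell 4 on along the predecessor certificate
    have hdark := kpProper_eventuallyDark_barrier hsy hca hO hDg hα1 hε.le hν.le hdat hvan hbdd hXc hode hnn
      (fun n => Finset.univ.filter (fun i : Fin 4 => ∀ j < n, c ((σ.symm ^ (j + 1)) i) ≠ 0))
      (fun i => by simp) (fun n i hi a ha => kpPerm_litCert_feed σ c n i hi a ha)
      (fun n i _ a _ b _ => kpPermTable_inshell σ c a b i) 4
      (fun n hn => kpPerm_litCert_dark σ c hj hdead n hn) t ht k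
    have hexp : (1 + ε₀) ^ (2 * θ₀ * (k : ℝ)) ≤ (1 + ε₀) ^ (2 * (k : ℝ)) := by
      refine Real.rpow_le_rpow_of_exponent_le hb1 ?_
      have hk0 : (0 : ℝ) ≤ (k : ℝ) := Nat.cast_nonneg k
      nlinarith
    have h0 : 0 ≤ (1 / 2 : ℝ) * X i (k : ℤ) t ^ 2 := by positivity
    have hD₀0 : 0 ≤ D₀ := le_trans zero_le_one hD₀
    calc (1 + ε₀) ^ (2 * θ₀ * (k : ℝ)) * ((1 / 2 : ℝ) * X i (k : ℤ) t ^ 2)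
        ≤ (1 + ε₀) ^ (2 * (k : ℝ)) * ((1 / 2 : ℝ) * X i (k : ℤ) t ^ 2) := mul_le_mul_of_nonneg_right hexp h0
      _ ≤ ((1 + ε₀) ^ 2) ^ 4 * E₀ := hdark
      _ ≤ (D₀ + ((1 + ε₀) ^ 2) ^ 4) * E₀ := by nlinarith

/-! ## §4 Discharged on `ε₀ ∈ [7/10, 1]` by ns-soc-p2's chain rung -/

/-- **MIXED PERMUTATION NETWORKS SATISFY THE PRIMARY GRADED BARRIER AT EVERY `ε₀ ∈ [7/10, 1]`** (`θ = 101/200`,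
`D = 100 + ((1+ε₀)²)^4`): §3 with the chain hypothesis discharged by `dyadicRange_shellBarrier` BY NAME (every
other chain rung of the LEAD lineage transfers identically on its range).  Example: `σ = (0 1)(2 3)`,
`c = (1, 1, 1, 0)` — the uniform re-entry pair on `{0,1}` next to the broken path `2 → 3`, in no landed rung
(RUNG 6/8 need `c` constant on every orbit).  MODEL lattice statement; no stub, crux or summit is proved.
[cite: BarbatoMorandinRomito2011, §3.2] [cite: Tao2016AveragedNS, §4 (4.13)] -/
theorem kpPerm_mixed_primaryGraded_range (σ : Equiv.Perm (Fin 4)) (c : Fin 4 → ℝ) {ε₀ : ℝ}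
    (hε : (7 : ℝ) / 10 ≤ ε₀) (hε1 : ε₀ ≤ 1)
    (hmix : ∀ i : Fin 4, ((∀ b, σ.SameCycle i b → c b = c i) ∧ c i ≠ 0) ∨
      ∃ j : ℕ, j < 4 ∧ c ((σ.symm ^ (j + 1)) i) = 0) (R : ℝ) :
    Literature.Analysis.FluidPDE.TaoCascade.InTableClass R (kpPermTable σ c) →
    (∀ (Y : Fin 4 → ℤ → ℝ → ℝ) (τ : ℝ), (∀ (j : Fin 4) (k : ℤ), 1 ≤ k → 0 ≤ Y j k τ) → ∀ δ : ℝ, 0 < δ →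
      ∀ (i : Fin 4) (n : ℤ), 1 ≤ n → Y i n τ = 0 →
        0 ≤ Literature.Analysis.FluidPDE.TaoCascade.quadTerm δ (kpPermTable σ c) Y i n τ) →
    (∀ a b i : Fin 4, a ≠ b → kpPermTable σ c a b i (0, 0, 1) = 0) →
    ∃ (lev : Fin 4 → ℕ) (L : ℕ), (∀ a, lev a ≤ L) ∧
      (∀ a, lev a ≠ 0 → (∃ e, kpPermTable σ c a a e (0, 0, 1) ≠ 0) →
        (∀ j, kpPermTable σ c j j a (0, 0, 1) ≠ 0 →
          lev j < lev a ∧ (lev j = 0 ∨ ∃ e', kpPermTable σ c j j e' (0, 0, 1) ≠ 0)) ∧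
        (∀ i₁ i₂, i₁ ≠ a → i₂ ≠ a → kpPermTable σ c i₁ i₂ a (0, 0, 0) ≠ 0 →
          (lev i₁ < lev a ∧ (lev i₁ = 0 ∨ ∃ e', kpPermTable σ c i₁ i₁ e' (0, 0, 1) ≠ 0)) ∧
          (lev i₂ < lev a ∧ (lev i₂ = 0 ∨ ∃ e', kpPermTable σ c i₂ i₂ e' (0, 0, 1) ≠ 0))) ∧
        (∃ e, kpPermTable σ c a a e (0, 0, 1) ≠ 0 ∧
          (∀ j, kpPermTable σ c e e j (0, 0, 1) ≠ 0 →
            lev j < lev a ∧ (lev j = 0 ∨ ∃ e', kpPermTable σ c j j e' (0, 0, 1) ≠ 0)) ∧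
          (∀ j, j ≠ e → kpPermTable σ c e e j (0, 0, 0) ≠ 0 →
            lev j < lev a ∧ (lev j = 0 ∨ ∃ e', kpPermTable σ c j j e' (0, 0, 1) ≠ 0)))) ∧
      ∃ θ : ℝ, 1 / 2 < θ ∧ θ ≤ 1 ∧ ∃ D : ℝ, 0 ≤ D ∧
        ∀ ν : ℝ, 0 < ν → ∀ (X₀ : Fin 4 → ℝ) (s : ℝ), 0 < s → ∀ X : Fin 4 → ℤ → ℝ → ℝ,
        (∀ (i : Fin 4) (k : ℤ), X i k 0 = if k = 0 then X₀ i else 0) →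
        (∀ (i : Fin 4) (k : ℤ), k < 0 → ∀ t : ℝ, X i k t = 0) →
        (∃ M : ℝ, ∀ (t : ℝ) (i : Fin 4) (k : ℤ), (1 + (1 + ε₀) ^ ((10 : ℝ) * k)) * |X i k t| ≤ M) →
        (∀ (i : Fin 4) (k : ℤ), Continuous (X i k)) →
        (∀ (i : Fin 4) (k : ℤ), ∀ t ∈ Set.Icc (0 : ℝ) s, HasDerivWithinAt (X i k)
          (Literature.Analysis.FluidPDE.TaoCascade.quadTerm ε₀ (kpPermTable σ c) X i k t -
            ν * (1 + ε₀) ^ ((2 : ℝ) * k) * X i k t) (Set.Icc (0 : ℝ) s) t) →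
        (∀ t ∈ Set.Icc (0 : ℝ) s, ∀ (i : Fin 4) (k : ℤ), 1 ≤ k → 0 ≤ X i k t) →
        ∀ t ∈ Set.Icc (0 : ℝ) s, ∀ i, lev i = 0 → ∀ k : ℕ,
          (1 + ε₀) ^ (2 * θ * (k : ℝ)) * ((1 / 2 : ℝ) * X i (k : ℤ) t ^ 2) ≤
            D * (∑ j : Fin 4, (1 / 2 : ℝ) * X₀ j ^ 2) :=
  kpPerm_mixed_primaryGraded_of_chain σ c (θ₀ := 101 / 200) (D₀ := 100) (by linarith) (by norm_num)
    (by norm_num) (by norm_num) hmix (fun a hca => dyadicRange_shellBarrier hca hε hε1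
      (α := fun i₁ i₂ i₃ μ => c a * dyadicTable i₁ i₂ i₃ μ) (fun _ _ _ _ => rfl)) R

end Summit.NavierStokesRegularity.NavierStokesRegularity.Theorems

end
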